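import Summits.CriticalPhenomena.CardyFormulaZ2.Theorems.CardyBoundaryCoulombGasHalfPlaneMarkDensityLawSelfDualityExact
import Summits.CriticalPhenomena.CardyFormulaZ2.Theorems.CardyBoundaryCoulombGasHalfPlaneMarkDensityLawEquicontinuity
import Literature.Probability.Percolation.Z2HalfPlaneThreeArm

/-!
# Lead's skeleton (c12-0), cycle 2: joint subsequential limits tend to `1` as the gap closes
# (crux `HalfPlaneMarkDensityLaw`, line `Sketch`, a-priori structure of the open stub C⁺)

`P_n(a,b,c,y) = P_{1/2}[[⌊an⌋,⌊bn⌋]×{0} ↔ [⌊cn⌋,⌊yn⌋]×{0} in ℤ×ℕ]`.  Claim: there are `C₁, α, K > 0` with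
`P_n(a,b,c,y) ≥ 1 − C₁ (2(c−b)/d)^α` eventually whenever `K (c−b) < d ≤ min (b−a) (y−c)`; hence every
joint subsequential limit `G` satisfies the same bound and `G(a,b,c,y) → 1` as `c ↓ b`.

Route (separation-free): if `A = [α',β]×{0}` is NOT joined to `C = [γ,δ]×{0}` inside `H`, close every
edge with an endpoint in `{x₀ < α'}`: the smaller configuration `ω̃` does not join the RAY `(−∞,β]×{0}`
to `C`, so the tree's "at least one" lemma `SelfDual.dual_of_not_primal` (finite clusters a.s.,
`SelfDual.ae_bounded_joined`) yields a legged dual path of `ω̃*` from a gap face `(b,0)`, `β ≤ b < γ`, to a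
face `(b',0)`, `b' ≥ δ`; a dual step of `ω̃*` between faces one of which has `x₀ ≥ α'` is a dual step of
`ω*` (the primal edge it crosses has both endpoints at `x₀ ≥ α'`), so the initial segment of
"leg + path" up to its first face at sup-distance `R ≤ min (δ−γ+1) (β−α'+1)` from `(b,0)` is a genuine
closed arm of `ω` inside `faceBox b R` from the moat face `(b,−1)`: `ω ∈ Z2HalfPlane.oneArm β (γ−β) R`,
an event of probability `≤ C₁ ((γ−β)/R)^α` (`Z2HalfPlane.real_oneArm_le`).
-/

noncomputable section

namespace Summit.CriticalPhenomena.CardyFormulaZ2.Cruxes.HalfPlaneMarkDensityLaw.SketchLine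

open Literature.Probability.Percolation Literature.Probability.LatticeModels
open Literature.Probability.Percolation.Z2HalfPlane (leg Far faceBox oneArm)
open MeasureTheory Filter Set SimpleGraph
open scoped Topology
open Summit.CriticalPhenomena.CardyFormulaZ2.Theorems.HalfPlaneMarkDensityLaw.Negative

namespace GapClose

/-- STUB G1 (deterministic): closing the edges with an endpoint left of the source arc, a configuration
not joining `[α',−S]×{0}` to `[1,X]×{0}` inside `H` does not join the ray `(−∞,−S]×{0}` to `[1,X]×{0}`.
[folklore] -/
theorem stub_notCross_erase :
    ∀ (ω : BondConfig (Site 2)) (α' S X : ℤ), α' ≤ -S → -S < 1 →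
      ω ∉ openCrossing halfPlane (rowIcc α' (-S)) (rowIcc 1 X) →
      ω \ {e | ∃ w ∈ e, w 0 < α'} ∉
        openCrossing halfPlane {v : Site 2 | v 1 = 0 ∧ v 0 ≤ -S} (rowIcc 1 X) := by
  sorry

/-- STUB G2 (deterministic): a dual-open step of `(ω ∖ L)*`, `L` the edges with an endpoint in
`{x₀ < α'}`, between two faces one of which has `x₀ ≥ α'`, is a dual-open step of `ω*`. [folklore] -/
theorem stub_dualStep_erase :
    ∀ (ω : BondConfig (Site 2)) (α' : ℤ) (z z' : Site 2), (zdGraph 2).Adj z z' →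
      s(z, z') ∈ dualConfig (ω \ {e | ∃ w ∈ e, w 0 < α'}) → (α' ≤ z 0 ∨ α' ≤ z' 0) →
      s(z, z') ∈ dualConfig ω := by
  sorry

/-- STUB G3 (deterministic, truncation): a legged dual path of `(ω ∖ L)*` from the gap face `(b,0)` to a
face `(b',0)` with `b' − b ≥ R` and `b − α' + 1 ≥ R` contains a closed arm of `ω` from the moat face
`(b,−1)` to sup-distance `R` inside `faceBox b R`. [folklore] -/
theorem stub_armOfLeggedPath :
    ∀ (ω : BondConfig (Site 2)) (α' b b' : ℤ) (R : ℕ),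
      (R : ℤ) ≤ b' - b → (R : ℤ) ≤ b - α' + 1 →
      leg b ∈ dualConfig (ω \ {e | ∃ w ∈ e, w 0 < α'}) →
      dualConfig (ω \ {e | ∃ w ∈ e, w 0 < α'}) ∈ openConnIn halfPlane ![b, 0] ![b', 0] →
      ∃ g : Site 2, Far R b g ∧ dualConfig ω ∈ openConnIn ↑(faceBox b R) ![b, -1] g := by
  sorry

/-- STUB G4 (deterministic assembly of G1–G3 with `SelfDual.dual_of_not_primal`): not joining the arcs
forces one closed arm from the moat under the gap window `[−S, 1)`. [folklore] -/
theorem stub_oneArm_of_notCross :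
    ∀ (ω : BondConfig (Site 2)) (α' S X : ℤ) (R N : ℕ), α' ≤ -S → 0 ≤ S → 1 ≤ X →
      (∀ y : Site 2, (∃ r ∈ rowIcc 1 X, ω ∈ openConnIn halfPlane r y) → |y 0| ≤ N ∧ y 1 ≤ N) →
      ω ∉ openCrossing halfPlane (rowIcc α' (-S)) (rowIcc 1 X) →
      (R : ℤ) ≤ X → (R : ℤ) ≤ -S - α' + 1 →
      ω ∈ oneArm (-S) (S.toNat + 1) R := by
  sorry

/-- STUB G5 (probability, lattice form): **`1 − P[[α',β] ↔ [γ,δ] in H] ≤ C₁ ((γ−β)/R)^α`** for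
`K₁ (γ−β) ≤ R ≤ min (δ−γ+1) (β−α'+1)`. [folklore] -/
theorem stub_one_sub_crossing_le :
    ∃ C₁ α : ℝ, 0 < C₁ ∧ 0 < α ∧ ∃ K₁ : ℕ, 1 ≤ K₁ ∧ ∀ (α' β γ δ : ℤ) (R : ℕ),
      α' ≤ β → β < γ → γ ≤ δ → (K₁ : ℤ) * (γ - β) ≤ R → (R : ℤ) ≤ δ - γ + 1 → (R : ℤ) ≤ β - α' + 1 →
        1 - C₁ * (((γ : ℝ) - β) / R) ^ α ≤ μ.real (openCrossing halfPlane (rowIcc α' β) (rowIcc γ δ)) := by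
  sorry

/-- STUB G6 (continuum): **`P_n(a,b,c,y) ≥ 1 − C₁ (2(c−b)/d)^α` eventually** for
`K (c−b) < d ≤ min (b−a) (y−c)`. [folklore] -/
theorem stub_eventually_ge_one_sub :
    ∃ C₁ α K : ℝ, 0 < C₁ ∧ 0 < α ∧ 0 < K ∧ ∀ (a b c y d : ℝ), a < b → b < c → c < y →
      K * (c - b) < d → d ≤ b - a → d ≤ y - c →
        ∀ᶠ n : ℕ in atTop, 1 - C₁ * (2 * (c - b) / d) ^ α ≤
          μ.real (openCrossing halfPlane (arcA a b n) (rowIcc ⌊c * n⌋ ⌊y * n⌋)) := by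
  sorry

/-- STUB G7 (lead, corollary): **every joint subsequential limit tends to `1` as the gap closes.** [folklore] -/
theorem stub_jointLimit_tendsto_one :
    ∀ {θ : ℕ → ℕ} {G : ℝ → ℝ → ℝ → ℝ → ℝ},
      (∀ a b c y : ℝ, a < b → b < c → c < y →
        Tendsto (fun n ↦ μ.real (openCrossing halfPlane (arcA a b (θ n))
          (rowIcc ⌊c * (θ n : ℕ)⌋ ⌊y * (θ n : ℕ)⌋))) atTop (𝓝 (G a b c y))) →
      StrictMono θ → ∀ {a b y : ℝ}, a < b → b < y →
        Tendsto (fun c ↦ G a b c y) (𝓝[>] b) (𝓝 1) := by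
  sorry

/-! ### Glue forms (each later stub from the statements of the earlier ones, so that all are provable in parallel) -/

/-- STUB G4' (glue): G1 and G3 (with `SelfDual.dual_of_not_primal`) give G4. [folklore] -/
theorem stub_oneArm_of_notCross_of :
    (∀ (ω : BondConfig (Site 2)) (α' S X : ℤ), α' ≤ -S → -S < 1 → ω ∉ openCrossing halfPlane (rowIcc α' (-S)) (rowIcc 1 X) → ω \ {e | ∃ w ∈ e, w 0 < α'} ∉ openCrossing halfPlane {v : Site 2 | v 1 = 0 ∧ v 0 ≤ -S} (rowIcc 1 X)) →
    (∀ (ω : BondConfig (Site 2)) (α' b b' : ℤ) (R : ℕ), (R : ℤ) ≤ b' - b → (R : ℤ) ≤ b - α' + 1 → leg b ∈ dualConfig (ω \ {e | ∃ w ∈ e, w 0 < α'}) → dualConfig (ω \ {e | ∃ w ∈ e, w 0 < α'}) ∈ openConnIn halfPlane ![b, 0] ![b', 0] → ∃ g : Site 2, Far R b g ∧ dualConfig ω ∈ openConnIn ↑(faceBox b R) ![b, -1] g) →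
    ∀ (ω : BondConfig (Site 2)) (α' S X : ℤ) (R N : ℕ), α' ≤ -S → 0 ≤ S → 1 ≤ X → (∀ y : Site 2, (∃ r ∈ rowIcc 1 X, ω ∈ openConnIn halfPlane r y) → |y 0| ≤ N ∧ y 1 ≤ N) → ω ∉ openCrossing halfPlane (rowIcc α' (-S)) (rowIcc 1 X) → (R : ℤ) ≤ X → (R : ℤ) ≤ -S - α' + 1 → ω ∈ oneArm (-S) (S.toNat + 1) R := by
  sorry

/-- STUB G5' (glue): G4 (with `SelfDual.ae_bounded_joined`, `Z2HalfPlane.real_oneArm_le`, `crossing_shift`) gives G5. [folklore] -/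
theorem stub_one_sub_crossing_le_of :
    (∀ (ω : BondConfig (Site 2)) (α' S X : ℤ) (R N : ℕ), α' ≤ -S → 0 ≤ S → 1 ≤ X → (∀ y : Site 2, (∃ r ∈ rowIcc 1 X, ω ∈ openConnIn halfPlane r y) → |y 0| ≤ N ∧ y 1 ≤ N) → ω ∉ openCrossing halfPlane (rowIcc α' (-S)) (rowIcc 1 X) → (R : ℤ) ≤ X → (R : ℤ) ≤ -S - α' + 1 → ω ∈ oneArm (-S) (S.toNat + 1) R) →
    ∃ C₁ α : ℝ, 0 < C₁ ∧ 0 < α ∧ ∃ K₁ : ℕ, 1 ≤ K₁ ∧ ∀ (α' β γ δ : ℤ) (R : ℕ), α' ≤ β → β < γ → γ ≤ δ → (K₁ : ℤ) * (γ - β) ≤ R → (R : ℤ) ≤ δ - γ + 1 → (R : ℤ) ≤ β - α' + 1 → 1 - C₁ * (((γ : ℝ) - β) / R) ^ α ≤ μ.real (openCrossing halfPlane (rowIcc α' β) (rowIcc γ δ)) := by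
  sorry

/-- STUB G6' (glue): G5 gives G6 (floors). [folklore] -/
theorem stub_eventually_ge_one_sub_of :
    (∃ C₁ α : ℝ, 0 < C₁ ∧ 0 < α ∧ ∃ K₁ : ℕ, 1 ≤ K₁ ∧ ∀ (α' β γ δ : ℤ) (R : ℕ), α' ≤ β → β < γ → γ ≤ δ → (K₁ : ℤ) * (γ - β) ≤ R → (R : ℤ) ≤ δ - γ + 1 → (R : ℤ) ≤ β - α' + 1 → 1 - C₁ * (((γ : ℝ) - β) / R) ^ α ≤ μ.real (openCrossing halfPlane (rowIcc α' β) (rowIcc γ δ))) →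
    ∃ C₁ α K : ℝ, 0 < C₁ ∧ 0 < α ∧ 0 < K ∧ ∀ (a b c y d : ℝ), a < b → b < c → c < y → K * (c - b) < d → d ≤ b - a → d ≤ y - c → ∀ᶠ n : ℕ in atTop, 1 - C₁ * (2 * (c - b) / d) ^ α ≤ μ.real (openCrossing halfPlane (arcA a b n) (rowIcc ⌊c * n⌋ ⌊y * n⌋)) := by
  sorry

/-- STUB G7' (glue): G6 gives G7 (squeeze between `1 − C₁(2(c−b)/d)^α` and `1`). [folklore] -/
theorem stub_jointLimit_tendsto_one_of :
    (∃ C₁ α K : ℝ, 0 < C₁ ∧ 0 < α ∧ 0 < K ∧ ∀ (a b c y d : ℝ), a < b → b < c → c < y → K * (c - b) < d → d ≤ b - a → d ≤ y - c → ∀ᶠ n : ℕ in atTop, 1 - C₁ * (2 * (c - b) / d) ^ α ≤ μ.real (openCrossing halfPlane (arcA a b n) (rowIcc ⌊c * n⌋ ⌊y * n⌋))) →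
    ∀ {θ : ℕ → ℕ} {G : ℝ → ℝ → ℝ → ℝ → ℝ}, (∀ a b c y : ℝ, a < b → b < c → c < y → Tendsto (fun n ↦ μ.real (openCrossing halfPlane (arcA a b (θ n)) (rowIcc ⌊c * (θ n : ℕ)⌋ ⌊y * (θ n : ℕ)⌋))) atTop (𝓝 (G a b c y))) → StrictMono θ → ∀ {a b y : ℝ}, a < b → b < y → Tendsto (fun c ↦ G a b c y) (𝓝[>] b) (𝓝 1) := by
  sorry

end GapClose

end Summit.CriticalPhenomena.CardyFormulaZ2.Cruxes.HalfPlaneMarkDensityLaw.SketchLine
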